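import Mathlib
import HarnessLib

/-!
# HodgeLocusCensusTwistedCore — kernel-checked core of the MONODROMY LEMMA and of the arithmetic of THEOREM T (cell pub-hlocus, LEAD gen 28; ruling R-L25)
HONEST FRAMING: certified instances and evidence bearing on the general Hodge conjecture; no claim.

Structural helper of the Hodge-locus census; nothing here is used by, or claims anything about, `Summit.HodgeConjecture`.
Record: `data/ivhs/census/og81/TWISTED-PAIRS-g28.md` §3–§5 (first-order classification of all pairs of STANDARD planes
`P_{M,ε} = V(x_a − ε_{ab} x_b : ab ∈ M)`, `ε³ = −1`, on the Fermat cubic).  Three pieces of that record are pure algebra / arithmetic and are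
kernel-checked here (definition-free, so that the file is a plain proof file):

* MONODROMY LEMMA core (§3).  On a cycle with transition factors `u₀, …, u_{n−1} ∈ K` (vertices `0 … n`, vertex `n` glued to vertex `0`) the
  flat sections `{y : y_{i+1} = u_i y_i (i < n), y_n = y_0}` are all multiples of the partial-product vector (`flatSection_eq_smul_partialProd`),
  that vector is itself flat iff the monodromy `∏ u_i` is `1` (`partialProd_flat_iff`), so a non-zero flat section exists iff `∏ u_i = 1`
  (`exists_flatSection_ne_zero_iff`) and the span of the flat sections has `finrank = 1` iff `∏ u_i = 1`, `= 0` otherwise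
  (`finrank_span_flatSections_eq_one_iff`, `span_flatSections_eq_bot`).  For the factors `−ω^{a_i}` of a pair of standard planes along a
  cycle of EVEN length `2L` the monodromy is `ω^{Σ a_i}` (`prod_neg_pow_fin_two_mul`), trivial iff `3 ∣ Σ a_i` (`monodromy_eq_one_iff`):
  `dim J(k_Z − 1, Z) = [Z consistent]` (`finrank_span_flatSections_cycle_eq_one_iff`, `exists_flatSection_cycle_ne_zero_iff`).
* THEOREM M / THEOREM T (ii) arithmetic (§4).  With the single-cycle ALIVE MENU (t ≥ 1 and (t = k_Z or (t = k_Z − 1 and Z consistent)))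
  every alive cycle has degree at least its share (`k_Z` twisted, `k_Z − 1` consistent) of `c′ = k − 1 − m`, so an all-alive degree
  distribution of total degree ≤ 3 forces `c′ ≤ 3` (`sum_share_le_sum_of_alive`, `not_all_alive_of_four_le_cprime`):
  no first-order excess on `ℂ^×` when `c′ ≥ 4`.
* STANDARD PAIR closed form vs PRINT (§5).  `mydim = 2·C(k,3) − C(k−c′,3) − C(k−c′, 3−c′)` (last term `0` for `c′ ≥ 4`), `intdim = 2·C(k,3) − C(k−c′,3)`
  (`k = n/2 + 1`, `c′ = n/2 − m ≥ 1`; both `C(k,3)` at `c′ = 0`) reproduce ALL 30 printed cells of Movasati(–Villaflor), *Why should one …*, §6 Table 1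
  (`(mydim³_n(m), intdim³_n(m))`, `4 ≤ n ≤ 12`; transcribed from the arXiv source in lit/TARGETS.md §T4-RECOVERED): `mv18Table1_reproduced` (by `decide`);
  and the shape statements `excess = 0 ↔ c′ ≥ 4` (Villaflor 2022 Thm 3 at `d = 3`), `excess = k − 2` at `c′ = 2` (Kloosterman 2025 Ex 4.2 with equality).
The Boolean-ring side (that `im α_{k_Z−1} ∩ im β_{k_Z−1}` IS this space of flat sections; the transfer lemmas; the join law) stays on paper in the record.
-/

namespace Summit.HodgeConjecture.HodgeConjecture.HodgeLocus.Census.TwistedCore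

open Finset Module

/-! ## 1. Flat sections of a rank-one system on a cycle (MONODROMY LEMMA core) -/
section FlatSections

variable {K : Type*} [Field K] {n : ℕ}

/-- The last partial product is the full product. -/
theorem partialProd_last_eq_prod {M : Type*} [CommMonoid M] (f : Fin n → M) :
    Fin.partialProd f (Fin.last n) = ∏ i, f i := by
  simp [Fin.partialProd, List.take_of_length_le, List.prod_ofFn]

/-- A section along the OPENED cycle (`y (i+1) = u i * y i` on every edge) is determined by its initial value:
`y i = (u₀ ⋯ u_{i−1}) · y 0`. -/
theorem pathSection_eq (u : Fin n → K) {y : Fin (n + 1) → K} (h : ∀ i : Fin n, y i.succ = u i * y (Fin.castSucc i))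
    (i : Fin (n + 1)) : y i = Fin.partialProd u i * y 0 := by
  induction i using Fin.inductionOn with
  | zero => simp
  | succ i ih => rw [h i, ih, Fin.partialProd_succ]; ring

/-- Every flat section (path section with `y n = y 0`; indeed every path section) is `y 0 •` the partial-product vector. -/
theorem flatSection_eq_smul_partialProd (u : Fin n → K) {y : Fin (n + 1) → K}
    (h : ∀ i : Fin n, y i.succ = u i * y (Fin.castSucc i)) : y = y 0 • (fun i => Fin.partialProd u i) := by
  funext i
  simp only [Pi.smul_apply, smul_eq_mul]
  rw [pathSection_eq u h i, mul_comm]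

/-- The partial-product vector is a path section … -/
theorem partialProd_pathSection (u : Fin n → K) (i : Fin n) :
    Fin.partialProd u i.succ = u i * Fin.partialProd u (Fin.castSucc i) := by
  simp only [Fin.partialProd_succ]; ring

/-- … and it is FLAT (closes up: value at `n` = value at `0`) iff the monodromy `∏ u` is `1`. -/
theorem partialProd_flat_iff (u : Fin n → K) :
    Fin.partialProd u (Fin.last n) = Fin.partialProd u 0 ↔ ∏ i, u i = 1 := by
  rw [partialProd_last_eq_prod, Fin.partialProd_zero]

/-- The partial-product vector is non-zero (its `0`-th entry is `1`). -/
theorem partialProd_ne_zero_fun (u : Fin n → K) : (fun i => Fin.partialProd u i) ≠ (0 : Fin (n + 1) → K) := by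
  intro h
  have := congrFun h 0
  simp at this

/-- A flat section with non-trivial monodromy vanishes identically. -/
theorem flatSection_eq_zero (u : Fin n → K) (hu : ∏ i, u i ≠ 1) {y : Fin (n + 1) → K}
    (h : ∀ i : Fin n, y i.succ = u i * y (Fin.castSucc i)) (hc : y (Fin.last n) = y 0) : y = 0 := by
  have h0 : y 0 = 0 := by
    have e := pathSection_eq u h (Fin.last n)
    rw [partialProd_last_eq_prod, hc] at e
    by_contra hne
    apply hu
    have : ((∏ i, u i) - 1) * y 0 = 0 := by rw [sub_mul, one_mul, ← e, sub_self]
    rcases mul_eq_zero.mp this with h1 | h1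
    · exact sub_eq_zero.mp h1
    · exact absurd h1 hne
  rw [flatSection_eq_smul_partialProd u h, h0, zero_smul]

/-- MONODROMY CRITERION: a non-zero flat section exists iff the monodromy is trivial. -/
theorem exists_flatSection_ne_zero_iff (u : Fin n → K) :
    (∃ y : Fin (n + 1) → K, (∀ i : Fin n, y i.succ = u i * y (Fin.castSucc i)) ∧ y (Fin.last n) = y 0 ∧ y ≠ 0) ↔
      ∏ i, u i = 1 := by
  constructor
  · rintro ⟨y, h, hc, hne⟩
    by_contra hu
    exact hne (flatSection_eq_zero u hu h hc)
  · intro hu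
    exact ⟨fun i => Fin.partialProd u i, partialProd_pathSection u, (partialProd_flat_iff u).mpr hu, partialProd_ne_zero_fun u⟩

/-- Trivial monodromy: the flat sections span the LINE of the partial-product vector. -/
theorem span_flatSections_eq_span_singleton (u : Fin n → K) (hu : ∏ i, u i = 1) :
    Submodule.span K {y : Fin (n + 1) → K | (∀ i : Fin n, y i.succ = u i * y (Fin.castSucc i)) ∧ y (Fin.last n) = y 0} =
      K ∙ (fun i => Fin.partialProd u i) := by
  apply le_antisymm
  · rw [Submodule.span_le]
    rintro y ⟨h, -⟩
    rw [SetLike.mem_coe, Submodule.mem_span_singleton]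
    exact ⟨y 0, (flatSection_eq_smul_partialProd u h).symm⟩
  · rw [Submodule.span_le, Set.singleton_subset_iff]
    exact Submodule.subset_span ⟨partialProd_pathSection u, (partialProd_flat_iff u).mpr hu⟩

/-- Non-trivial monodromy: the flat sections span `0`. -/
theorem span_flatSections_eq_bot (u : Fin n → K) (hu : ∏ i, u i ≠ 1) :
    Submodule.span K {y : Fin (n + 1) → K | (∀ i : Fin n, y i.succ = u i * y (Fin.castSucc i)) ∧ y (Fin.last n) = y 0} = ⊥ := by
  rw [Submodule.span_eq_bot]
  rintro y ⟨h, hc⟩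
  exact flatSection_eq_zero u hu h hc

/-- MONODROMY CRITERION, dimension form: `finrank (flat sections) = 1 ↔ ∏ u = 1` (and `= 0` otherwise, by `span_flatSections_eq_bot`). -/
theorem finrank_span_flatSections_eq_one_iff (u : Fin n → K) :
    finrank K (Submodule.span K
      {y : Fin (n + 1) → K | (∀ i : Fin n, y i.succ = u i * y (Fin.castSucc i)) ∧ y (Fin.last n) = y 0}) = 1 ↔ ∏ i, u i = 1 := by
  constructor
  · intro h1
    by_contra hu
    rw [span_flatSections_eq_bot u hu, finrank_bot] at h1
    exact zero_ne_one h1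
  · intro hu
    rw [span_flatSections_eq_span_singleton u hu, finrank_span_singleton (partialProd_ne_zero_fun u)]

/-! ### The factors of a pair of standard planes along one cycle: `u_i = −ω^{a_i}`, even length -/

/-- Along a cycle of even length `2L` the signs cancel: `∏ (−ω^{a_i}) = ω^{Σ a_i}`. -/
theorem prod_neg_pow_fin_two_mul (ω : K) (L : ℕ) (a : Fin (2 * L) → ℕ) :
    ∏ i, (-(ω ^ a i)) = ω ^ (∑ i, a i) := by
  have h1 : ∏ i : Fin (2 * L), (-(ω ^ a i)) = ∏ i : Fin (2 * L), ((-1) * ω ^ a i) := by simp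
  rw [h1, Finset.prod_mul_distrib, Finset.prod_const, Finset.card_univ, Fintype.card_fin, pow_mul, neg_one_sq, one_pow,
    one_mul, Finset.prod_pow_eq_pow_sum]

/-- The monodromy of a pair of standard planes around a cycle is trivial iff the holonomy `Σ a_i` is `0 mod 3`. -/
theorem monodromy_eq_one_iff {ω : K} (hω : IsPrimitiveRoot ω 3) (L : ℕ) (a : Fin (2 * L) → ℕ) :
    ∏ i, (-(ω ^ a i)) = 1 ↔ 3 ∣ ∑ i, a i := by
  rw [prod_neg_pow_fin_two_mul, hω.pow_eq_one_iff_dvd]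

/-- MONODROMY LEMMA, core: a non-zero flat section for the factors `−ω^{a_i}` exists iff the cycle is CONSISTENT (`3 ∣ Σ a_i`). -/
theorem exists_flatSection_cycle_ne_zero_iff {ω : K} (hω : IsPrimitiveRoot ω 3) (L : ℕ) (a : Fin (2 * L) → ℕ) :
    (∃ y : Fin (2 * L + 1) → K,
        (∀ i : Fin (2 * L), y i.succ = -(ω ^ a i) * y (Fin.castSucc i)) ∧ y (Fin.last (2 * L)) = y 0 ∧ y ≠ 0) ↔ 3 ∣ ∑ i, a i := by
  rw [exists_flatSection_ne_zero_iff, monodromy_eq_one_iff hω]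

/-- MONODROMY LEMMA, dimension form: `dim J(k_Z − 1, Z) = 1` iff the cycle is consistent (else the span is `⊥`). -/
theorem finrank_span_flatSections_cycle_eq_one_iff {ω : K} (hω : IsPrimitiveRoot ω 3) (L : ℕ) (a : Fin (2 * L) → ℕ) :
    finrank K (Submodule.span K {y : Fin (2 * L + 1) → K |
      (∀ i : Fin (2 * L), y i.succ = -(ω ^ a i) * y (Fin.castSucc i)) ∧ y (Fin.last (2 * L)) = y 0}) = 1 ↔ 3 ∣ ∑ i, a i := by
  rw [finrank_span_flatSections_eq_one_iff, monodromy_eq_one_iff hω]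

end FlatSections

/-! ## 2. The single-cycle ALIVE MENU (THEOREM M) and the arithmetic of THEOREM T (ii) -/
section Menu

/-- THEOREM M's menu for a block `(t, Z)` on a base cycle of length `2 k_Z`: alive iff `t ≥ 1 ∧ (t = k_Z ∨ (Z consistent ∧ t + 1 = k_Z))`.
An alive block has degree at least the cycle's share of `c′` (`k_Z` if twisted, `k_Z − 1` if consistent). -/
theorem share_le_of_alive {t kZ : ℕ} {cons : Bool} (h : 1 ≤ t ∧ (t = kZ ∨ (cons = true ∧ t + 1 = kZ))) :
    (if cons then kZ - 1 else kZ) ≤ t := by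
  rcases h with ⟨_, h | ⟨hc, h⟩⟩
  · subst h; split_ifs <;> omega
  · simp [hc]; omega

/-- In an all-alive degree distribution the total degree is at least `c′ = Σ shares`. -/
theorem sum_share_le_sum_of_alive {ι : Type*} (s : Finset ι) (t kZ : ι → ℕ) (cons : ι → Bool)
    (h : ∀ i ∈ s, 1 ≤ t i ∧ (t i = kZ i ∨ (cons i = true ∧ t i + 1 = kZ i))) :
    ∑ i ∈ s, (if cons i then kZ i - 1 else kZ i) ≤ ∑ i ∈ s, t i :=
  Finset.sum_le_sum fun i hi => share_le_of_alive (h i hi)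

/-- THEOREM T (ii), arithmetic step: if `c′ ≥ 4` no degree distribution of total degree `≤ 3` is all-alive
(so, by THEOREM G, every block of the first-order pencil is dead: `e ≡ 0` on `ℂ^×`). -/
theorem not_all_alive_of_four_le_cprime {ι : Type*} (s : Finset ι) (t kZ : ι → ℕ) (cons : ι → Bool)
    (h4 : 4 ≤ ∑ i ∈ s, (if cons i then kZ i - 1 else kZ i)) (h3 : ∑ i ∈ s, t i ≤ 3) :
    ¬ ∀ i ∈ s, 1 ≤ t i ∧ (t i = kZ i ∨ (cons i = true ∧ t i + 1 = kZ i)) := fun h =>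
  absurd (le_trans h4 (sum_share_le_sum_of_alive s t kZ cons h)) (by omega)

end Menu

/-! ## 3. The standard pair `(P, P̌)`: closed form vs Movasati–Villaflor Table 1 -/
section StandardPair

/-- The closed form of Cor. T3 REPRODUCES PRINT.  Each entry is `(n, c′, mydim, intdim)` with `c′ = n/2 − m`, VERBATIM from MV18 Table 1
(rows `n = 4, 6, 8, 10, 12`, columns `c′ = 0 … n/2 + 1`); the test evaluates, with `k = n/2 + 1` and `j = k − c′ = m + 1`,
`intdim = 2·C(k,3) − C(j,3)` and `mydim = intdim − e`, `e = C(j, 3 − c′)` for `c′ ≤ 3`, `0` for `c′ ≥ 4` (and `mydim = intdim = C(k,3)` at `c′ = 0`). -/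
theorem mv18Table1_reproduced :
    (([(4, 0, 1, 1), (4, 1, 1, 2), (4, 2, 1, 2), (4, 3, 1, 2),
       (6, 0, 4, 4), (6, 1, 4, 7), (6, 2, 6, 8), (6, 3, 7, 8), (6, 4, 8, 8),
       (8, 0, 10, 10), (8, 1, 10, 16), (8, 2, 16, 19), (8, 3, 19, 20), (8, 4, 20, 20), (8, 5, 20, 20),
       (10, 0, 20, 20), (10, 1, 20, 30), (10, 2, 32, 36), (10, 3, 38, 39), (10, 4, 40, 40), (10, 5, 40, 40), (10, 6, 40, 40),
       (12, 0, 35, 35), (12, 1, 35, 50), (12, 2, 55, 60), (12, 3, 65, 66), (12, 4, 69, 69), (12, 5, 70, 70), (12, 6, 70, 70),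
       (12, 7, 70, 70)] : List (ℕ × ℕ × ℕ × ℕ)).all
      fun r =>
        (if r.2.1 = 0 then Nat.choose (r.1 / 2 + 1) 3
          else 2 * Nat.choose (r.1 / 2 + 1) 3 - Nat.choose (r.1 / 2 + 1 - r.2.1) 3
               - (if r.2.1 ≤ 3 then Nat.choose (r.1 / 2 + 1 - r.2.1) (3 - r.2.1) else 0)) == r.2.2.1 &&
        (if r.2.1 = 0 then Nat.choose (r.1 / 2 + 1) 3
          else 2 * Nat.choose (r.1 / 2 + 1) 3 - Nat.choose (r.1 / 2 + 1 - r.2.1) 3) == r.2.2.2) = true := by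
  decide

/-- Villaflor 2022 Thm 3 at `d = 3` in the closed form: the excess `e = C(k − c′, 3 − c′)` (`0` for `c′ ≥ 4`) vanishes iff `c′ ≥ 4`,
i.e. iff `m < n/2 − 3` (`1 ≤ c′ ≤ k`, `k = n/2 + 1 ≥ 3`). -/
theorem excess_eq_zero_iff {k c : ℕ} (hk3 : 3 ≤ k) (h1 : 1 ≤ c) (hk : c ≤ k) :
    (if c ≤ 3 then Nat.choose (k - c) (3 - c) else 0) = 0 ↔ 4 ≤ c := by
  split_ifs with h
  · constructor
    · intro h0
      exact absurd h0 (Nat.choose_pos (by omega)).ne'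
    · intro; omega
  · simp; omega

/-- Kloosterman 2025 Prop 4.1 / Ex 4.2 with EQUALITY at the Fermat point: `e = 1` at `c′ = 3` and `e = k − 2 = n/2 − 1` at `c′ = 2`. -/
theorem excess_three_two (k : ℕ) : Nat.choose (k - 3) (3 - 3) = 1 ∧ Nat.choose (k - 2) (3 - 2) = k - 2 := by
  simp

end StandardPair

end Summit.HodgeConjecture.HodgeConjecture.HodgeLocus.Census.TwistedCore
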